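import Summits.SmoothPoincare4.SmoothPoincare4.Theses.SblfDescent

/-!
# SmoothPoincare4 / SblfDescent — assembly

Settles item stmt-SmoothPoincare4-18532 (assembly of route SblfDescent, rev 1):
`SblfExists → RungOne → StepTwo → StepGE3 → SmoothPoincare4`.

Pure logic, an ℕ-induction on the lower genus `h` of a simplified broken Lefschetz fibration on a
smooth homotopy 4-sphere `M`: `SblfExists` gives some `h` with `HAS(M, h)`; `StepTwo` lowers
`h = 1` to `h = 0`, `StepGE3` lowers `h + 2` to `h + 1` (for `h + 1 ≥ 1`), and `RungOne` turns
`HAS(M, 0)` into a diffeomorphism `M ≃ₘ S⁴`, which is the shape of the problem statement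
`SmoothPoincare4`.  This is exactly the route file's own deciding theorem `SblfDescent.closes`
(kernel-checked there); the item's body is literally its type, so we apply it.  Nothing else is
used (no named facts, unconditional).
-/

-- the registered namespace `Summit.SmoothPoincare4.SmoothPoincare4.Theorems` repeats a component
set_option linter.dupNamespace false

namespace Summit.SmoothPoincare4.SmoothPoincare4.Theorems

open Summit.SmoothPoincare4.SmoothPoincare4.Theses.SblfDescent

/-- Settles stmt-SmoothPoincare4-18532: the assembly
`SblfExists → RungOne → StepTwo → StepGE3 → SmoothPoincare4` of route SblfDescent.
Proof: unfold `Assembly` and apply the route's deciding theorem `SblfDescent.closes` (induction on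
the lower genus: the existence support gives a rung, the two cruxes descend it to genus one, the
genus-one rung recognises `S⁴`). [folklore] -/
theorem sblfDescent_assembly_proof :
    Summit.SmoothPoincare4.SmoothPoincare4.Theses.SblfDescent.Assembly := by
  unfold Assembly
  intro hex h1 h2 h3
  exact closes hex h1 h2 h3

end Summit.SmoothPoincare4.SmoothPoincare4.Theorems
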